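import Summits.QuantumFields.YangMills.Theorems.BalabanUVNodesN16ApproximateSchemeTransferSteps
import Summits.QuantumFields.YangMills.Theorems.BalabanUVNodesN16Eq42LipschitzSmallField
import Summits.QuantumFields.BalabanUV.T4Continuum.Support.MinimalActionCompact
import HarnessLib

/-!
# YM-DAG node N16 (NE3), the located averaging pin (42) ↔ (0.4) — part 31: LIPSCHITZ CONTROL OF THE `k`-FOLD AVERAGE (43) ALONG THE ORBIT in the small-PLAQUETTE
# currency (constant `(e(4d+5)L)^k`), and its packaging as part 29's `LipschitzNear` for (43): the (43)-target induction with its Lipschitz input DISCHARGED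

Cell `pub-ymgap`, width seat `pub-ymgap-dag-n16-w3` (director-ym №197 ∕ HUMAN RULING D-0149), generation 9; part 31 of the W1b lineage (part 29
`…N16ApproximateSchemeTransferSteps`: `StepNear`, `LipschitzNear`, `approx_step42_target_of_steps`; part 30 `…N16Eq42LipschitzSmallField`: the one-step constant `e(4d+5)L`;
pub-balaban's `MinimalActionCompact.avgIter_unitary_smallField_two` = [Balaban1985Averaging] Prop. 2 (54) BY NAME: the (43)-orbit of a small-plaquette `U(N)` field stays
`U(N)`-valued and small-plaquette, radius `2ε` at every level).  `--kind proof --supports stmt-QuantumFields-27366 --as helper` (K3⁸, KEY MAP v2; count-neutral; 0 `def`).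

WHAT IS PROVED.
 * §1 `smallField_of_near` — a `U(N)` configuration bondwise `η`-close to a `U(N)` configuration with plaquettes within `a` of `1` has plaquettes within `a + 4η` of `1`
   (part 30's `norm_hol_sub_hol_le` on the plaquette word); so a competitor `η`-close to a member of the depth-`k` class with radius `ε∕(L^k)²` is itself in the class with
   radius `2ε∕(L^k)²` once `4η(L^k)² ≤ ε` (`smallField_level_of_near`).
 * §2 ★★ `norm_avgIter_sub_avgIter_le` — ALONG (43): `L ≥ 2`, `V′` `U(N)`-valued with `SmallField V′ (ε∕(L^k)²)`, `V` `U(N)`-valued with `‖V − V′‖_bond ≤ η`, `0 ≤ η`,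
   `4η(L^k)² ≤ ε`, regime `0 ≤ ε`, `32C₀(d)ε ≤ 3`, `2048(d+1)(d+4)L²ε ≤ 1` (Prop. 2's regime for the doubled radius) and `8(d+1)L·(e(4d+5)L)^k·η ≤ 1` ⇒ for every `j ≤ k`,
   `‖Ū^j(b) − Ū′^j(b)‖ ≤ (e(4d+5)L)^j·η` at every bond — induction on `j`: both orbits stay `U(N)`-valued and `2ε`∕`4ε`-small-plaquette by Prop. 2, so part 30's one-step bound
   applies at every level.
 * §3 ★★ `lipschitzNear_step42_sfClass` — THE PACKAGING: for every `k`, `LipschitzNear d (step42 L) k {U(N)-valued} (sfClass d L N ε k) η₀ (e(4d+5)L)^k` with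
   `η₀ = min (ε∕(4(L^k)²)) (1∕(8(d+1)L(e(4d+5)L)^k))` (g0's dictionary `avgIterS_step42`); `isUnitaryCfg_step42_of_mem_sfClass` — the class-propagation input `hmap₂` of part
   29's (43)-target induction (`step42 U` is `U(N)`-valued for `U ∈ sfClass d L N ε (k+1)`, Prop. 2 at `j = 1`); ★★★ `approx_step42_target_of_steps_sfClass` — part 29's
   induction for the pair (`s`, (43)) on N16's classes `𝒞 k = sfClass d L N ε k` with the LIPSCHITZ INPUT AND `hmap₂` DISCHARGED: displayed remain ONLY the one-step defects
   `StepNear d s (step42 L) L N j (sfClass … (j+1)) (η j)` with `η j ≤ η₀ j`, the class propagation `s (j+1) '' sfClass (j+1) ⊆ sfClass j` and block-lift clause of `s`, and the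
   defect recursion `(e(4d+5)L)^j·η j + δ j ≤ δ (j+1)`; the gauge group `Γ ≤ U(N)` is a parameter (part 27′; `SU(N)` for the (0.4) side) — for `s := step04 F N` read on
   `SU(N)`-valued sub-classes these are exactly what parts 22∕25∕26 measure per step, in their own currency.
   §3 also: `approx_step42_target_of_steps_subclass` (any `Γ`-invariant sub-class family `𝒞 k ⊆ sfClass …`), `gaugeAct_mem_sfClass_inter` (the `Γ`-valued part of the
   small-field class is `Γ`-invariant), ★★★ `approx_step42_target_of_steps_memClass` (the packaging on `{U ∈ sfClass … k | U Γ-valued}` — `Γ = SU(N)`: the class the (0.4)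
   side of record must be read on).
READING (honest; self-refereed scope).  Constants are crude (`(e(4d+5)L)^k`, GROWING with `k`): the recursion controls `δ_k` only if the per-step defects decay faster than
`(e(4d+5)L)^{−j}`, which depth-uniform per-step bounds (parts 22∕25∕26) do not give — a depth-uniform closeness needs the contraction of averaging on fluctuations, not sup-norm
Lipschitz iteration; and the END-number pin between (42) and (0.4) (different functionals at unit block scale, different limiting minimal actions) is NOT a closeness statement
but part 28 §1's geometrically Cauchy discrepancy.  This file records the closeness road (valid for asymptotically equivalent schemes) with (43)'s inputs discharged.  Nothing of
the (0.4) scheme of record is proved.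

HONEST FRAMING.  [folklore] bookkeeping BY NAME over parts 29∕30 and pub-balaban's `MinimalActionCompact.avgIter_unitary_smallField_two` ([Balaban1985Averaging] Prop. 2 (54),
a kernel theorem of the tree); 0 `def`, 0 `sorry`, no `instance`, no `notation`; no inequality of the paper asserted hypothesis-free; K3⁸ stubs `stub_rates13HV` ∕
`stub_expansion13HV` NOT touched; N16 ∕ NE3 NOT discharged; count-neutral (typed 28∕28 · discharged 5∕27 work-bound, A 5∕28 — unmoved).  One finite four-torus programme at
fixed `ε` — the Yang–Mills mass gap (Clay) is NOT proved by any of this; R4 closes the conditional finite-𝕋⁴ rung `BalabanLadder.UV` only; nothing continuum ∕ ℝ⁴ ∕ OS.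
-/

set_option autoImplicit false

open scoped BigOperators Matrix Matrix.Norms.L2Operator
open NormedSpace

namespace Summit.QuantumFields.YangMills.BalabanUVNodes.N16Eq42LipschitzOrbit

open Literature.MathematicalPhysics.QuantumFieldTheory.Balaban1983to89
open B7Prop1Explicit B7Prop2Explicit
open T4AveragingDeficitWall (IsUnitaryCfg SmallField)
open Summit.QuantumFields.BalabanUV.T4Continuum
open MinimalActionRate (sfClass)
open MinimalActionCompact (avgIter_unitary_smallField_two)
open NE3EnergyShapes (IsUnitarySite IsPeriodicSite)
open Summit.QuantumFields.YangMills.BalabanUVNodes.N16AveragingPin (avgIterS step42 avgIterS_step42)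
open Summit.QuantumFields.YangMills.BalabanUVNodes.N16ApproximateSchemeTransfer (CfgNear)
open Summit.QuantumFields.YangMills.BalabanUVNodes.N16ApproximateSchemeTransferSub (ApproxSchemeGaugeEquivIn)
open Summit.QuantumFields.YangMills.BalabanUVNodes.N16ApproximateSchemeTransferSteps (StepNear LipschitzNear LipschitzNear.anti approx_step42_target_of_steps)
open Summit.QuantumFields.YangMills.BalabanUVNodes.N16Eq42LipschitzSmallField (norm_hol_sub_hol_le norm_step42_sub_step42_le_of_smallField)

noncomputable section

variable {d : ℕ} {n : Type*} [Fintype n] [DecidableEq n]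

/-! ## §1 Plaquettes of bondwise-close unitary configurations -/

section Plaquettes

variable {V V' : Site d → Fin d → (Matrix n n ℂ)ˣ} {η a : ℝ}

/-- **CLOSE UNITARY CONFIGURATIONS HAVE CLOSE PLAQUETTES**: `‖V − V′‖_bond ≤ η`, both `U(N)`-valued, `SmallField V′ a` ⇒ `SmallField V (a + 4η)` (the plaquette word has
four letters; part 30's `norm_hol_sub_hol_le`). [folklore] -/
theorem smallField_of_near (hV : IsUnitaryCfg V) (hV' : IsUnitaryCfg V')
    (hnear : ∀ (x : Site d) (i : Fin d), ‖((V x i : (Matrix n n ℂ)ˣ) : Matrix n n ℂ) - ((V' x i : (Matrix n n ℂ)ˣ) : Matrix n n ℂ)‖ ≤ η)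
    (hsf : SmallField V' a) : SmallField V (a + 4 * η) := by
  intro x κ κ' hκ
  have h1 := norm_hol_sub_hol_le hV hV' hnear x (plaqWord κ κ')
  have hlen : (plaqWord κ κ' : List (Letter d)).length = 4 := rfl
  rw [hlen] at h1
  have h2 := hsf x κ κ' hκ
  calc ‖((hol V x (plaqWord κ κ') : (Matrix n n ℂ)ˣ) : Matrix n n ℂ) - 1‖
      ≤ ‖((hol V x (plaqWord κ κ') : (Matrix n n ℂ)ˣ) : Matrix n n ℂ) - ((hol V' x (plaqWord κ κ') : (Matrix n n ℂ)ˣ) : Matrix n n ℂ)‖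
          + ‖((hol V' x (plaqWord κ κ') : (Matrix n n ℂ)ˣ) : Matrix n n ℂ) - 1‖ := norm_sub_le_norm_sub_add_norm_sub _ _ _
    _ ≤ (4 : ℕ) * η + a := add_le_add h1 h2
    _ = a + 4 * η := by push_cast; ring

/-- **AT THE DEPTH-`k` RADIUS**: `SmallField V′ (ε∕(L^k)²)` and `4η(L^k)² ≤ ε` ⇒ `SmallField V (2ε∕(L^k)²)` (`1 ≤ L`). [folklore] -/
theorem smallField_level_of_near {L k : ℕ} (hL : 1 ≤ L) {ε : ℝ} (hV : IsUnitaryCfg V) (hV' : IsUnitaryCfg V')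
    (hnear : ∀ (x : Site d) (i : Fin d), ‖((V x i : (Matrix n n ℂ)ˣ) : Matrix n n ℂ) - ((V' x i : (Matrix n n ℂ)ˣ) : Matrix n n ℂ)‖ ≤ η)
    (hsf : SmallField V' (ε / ((L : ℝ) ^ k) ^ 2)) (hηε : 4 * η * ((L : ℝ) ^ k) ^ 2 ≤ ε) :
    SmallField V (2 * ε / ((L : ℝ) ^ k) ^ 2) := by
  have hLk : (0 : ℝ) < ((L : ℝ) ^ k) ^ 2 := by
    have : (0 : ℝ) < (L : ℝ) := by exact_mod_cast (by omega : 0 < L)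
    positivity
  refine MinimalActionRate.SmallField.mono (smallField_of_near hV hV' hnear hsf) ?_
  rw [div_add' _ _ _ hLk.ne', div_le_div_iff_of_pos_right hLk]
  linarith

end Plaquettes

/-! ## §2 Along (43): both orbits stay `U(N)`-valued and small-plaquette (Prop. 2), so the one-step bound iterates -/

section Orbit

variable [Nonempty n] {L : ℕ} (hL : 2 ≤ L) {V V' : Site d → Fin d → (Matrix n n ℂ)ˣ} {η ε : ℝ} {k : ℕ}
  (hV : IsUnitaryCfg V) (hV' : IsUnitaryCfg V')
  (hnear : ∀ (x : Site d) (i : Fin d), ‖((V x i : (Matrix n n ℂ)ˣ) : Matrix n n ℂ) - ((V' x i : (Matrix n n ℂ)ˣ) : Matrix n n ℂ)‖ ≤ η)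
  (hη : 0 ≤ η) (hε0 : 0 ≤ ε) (hε1 : 32 * C0 d * ε ≤ 3) (hε2 : 2048 * (d + 1) * (d + 4) * (L : ℝ) ^ 2 * ε ≤ 1)
  (hV'ε : SmallField V' (ε / ((L : ℝ) ^ k) ^ 2)) (hηε : 4 * η * ((L : ℝ) ^ k) ^ 2 ≤ ε)
  (hηk : 8 * (d + 1) * (L : ℝ) * ((Real.exp 1 * ((4 * d + 5) * L)) ^ k * η) ≤ 1)
include hL hV hV' hnear hη hε0 hε1 hε2 hV'ε hηε hηk

/-- **★★ LIPSCHITZ CONTROL OF (43) ALONG THE ORBIT** (small-plaquette currency): for every `j ≤ k` and every bond, `‖Ū^j(b) − Ū′^j(b)‖ ≤ (e(4d+5)L)^j·η`.  Induction: at level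
`j < k` both `Ū^j`, `Ū′^j` are `U(N)`-valued, `Ū′^j` is `2ε`-small-plaquette ([Balaban1985Averaging] Prop. 2 via `avgIter_unitary_smallField_two`; the competitor's orbit through
§1's doubled radius), and `8(d+1)L·(e(4d+5)L)^j η ≤ 1`, so part 30's one-step bound multiplies the closeness by `e(4d+5)L`. [folklore] -/
theorem norm_avgIter_sub_avgIter_le : ∀ {j : ℕ}, j ≤ k → ∀ (x : Site d) (i : Fin d),
    ‖((avgIter L V j x i : (Matrix n n ℂ)ˣ) : Matrix n n ℂ) - ((avgIter L V' j x i : (Matrix n n ℂ)ˣ) : Matrix n n ℂ)‖ ≤ (Real.exp 1 * ((4 * d + 5) * L)) ^ j * η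
  | 0, _, x, i => by simpa using hnear x i
  | j + 1, hj, x, i => by
    have hj' : j ≤ k := Nat.le_of_succ_le hj
    have hL1 : 1 ≤ L := le_trans (by norm_num) hL
    have hL1r : (1 : ℝ) ≤ L := by exact_mod_cast hL1
    -- the regime letters of Prop. 2 for the base (radius `ε`) and the competitor (radius `2ε`)
    have hε1' : 16 * C0 d * ε ≤ 3 := by have := C0_pos d; nlinarith
    have hε2' : 1024 * (d + 1) * (d + 4) * (L : ℝ) ^ 2 * ε ≤ 1 := by
      have : (0 : ℝ) ≤ 1024 * (d + 1) * (d + 4) * (L : ℝ) ^ 2 * ε := by positivity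
      linarith
    have h2ε0 : 0 ≤ 2 * ε := by linarith
    have h2ε1 : 16 * C0 d * (2 * ε) ≤ 3 := by linarith
    have h2ε2 : 1024 * (d + 1) * (d + 4) * (L : ℝ) ^ 2 * (2 * ε) ≤ 1 := by linarith
    have hVε : SmallField V (2 * ε / ((L : ℝ) ^ k) ^ 2) := smallField_level_of_near hL1 hV hV' hnear hV'ε hηε
    -- both level-`j` averages are unitary; the base's is `2ε`-small-plaquette
    obtain ⟨hVj, -⟩ := avgIter_unitary_smallField_two hL hV h2ε0 h2ε1 h2ε2 hVε hj'
    obtain ⟨hV'j, hV'js⟩ := avgIter_unitary_smallField_two hL hV' hε0 hε1' hε2' hV'ε hj'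
    -- the induction hypothesis and the radius condition at level `j`
    have IH := norm_avgIter_sub_avgIter_le hj'
    set Λ : ℝ := Real.exp 1 * ((4 * d + 5) * L) with hΛ
    have hΛ1 : 1 ≤ Λ := by
      rw [hΛ]
      have he : (1 : ℝ) ≤ Real.exp 1 := by have := Real.add_one_le_exp (1 : ℝ); linarith
      have h45 : (1 : ℝ) ≤ (4 * d + 5) * L := by
        have hd : (0 : ℝ) ≤ d := by positivity
        nlinarith
      nlinarith
    have hpow : Λ ^ j ≤ Λ ^ k := pow_le_pow_right₀ hΛ1 hj'
    have hηj : 0 ≤ Λ ^ j * η := mul_nonneg (pow_nonneg (by positivity) _) hη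
    have hη8j : 8 * (d + 1) * (L : ℝ) * (Λ ^ j * η) ≤ 1 := by
      have : 8 * (d + 1) * (L : ℝ) * (Λ ^ j * η) ≤ 8 * (d + 1) * (L : ℝ) * (Λ ^ k * η) := by
        have h8 : (0 : ℝ) ≤ 8 * (d + 1) * (L : ℝ) := by positivity
        exact mul_le_mul_of_nonneg_left (mul_le_mul_of_nonneg_right hpow hη) h8
      exact this.trans hηk
    have hsmall : 512 * (d + 1) * (d + 4) * (L : ℝ) ^ 2 * (2 * ε) ≤ 1 := by linarith
    have h := norm_step42_sub_step42_le_of_smallField hL1 hVj hV'j (fun x i => IH x i) hηj hη8j h2ε0 hsmall hV'js x i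
    rw [avgIter_succ, avgIter_succ]
    refine h.trans (le_of_eq ?_)
    rw [hΛ]
    ring

end Orbit

/-! ## §3 The packaging for part 29: `LipschitzNear` for (43) on N16's classes, `hmap₂`, and the (43)-target induction with these inputs discharged -/

section Packaging

variable [Nonempty n] {L N : ℕ} (hL : 2 ≤ L) {ε : ℝ} (hε0 : 0 ≤ ε) (hε1 : 32 * C0 d * ε ≤ 3) (hε2 : 2048 * (d + 1) * (d + 4) * (L : ℝ) ^ 2 * ε ≤ 1)
include hL hε0 hε1 hε2

/-- **★★ `LipschitzNear` FOR (43) AT EVERY DEPTH, SMALL-PLAQUETTE CURRENCY**: on N16's class `sfClass d L N ε k`, with competitors the `U(N)`-valued configurations, the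
`k`-fold (43)-average is `(e(4d+5)L)^k`-Lipschitz within bondwise radius `η₀ = min (ε∕(4(L^k)²)) (1∕(8(d+1)L(e(4d+5)L)^k))` (regime `0 ≤ ε`, `32C₀(d)ε ≤ 3`,
`2048(d+1)(d+4)L²ε ≤ 1`, `L ≥ 2`).  Part 29's displayed Lipschitz input for the (43)-target induction, DISCHARGED. [folklore] -/
theorem lipschitzNear_step42_sfClass (k : ℕ) :
    LipschitzNear d (fun _ => step42 (n := n) L) k {V | IsUnitaryCfg V} (sfClass d L N ε k)
      (min (ε / (4 * ((L : ℝ) ^ k) ^ 2)) (1 / (8 * (d + 1) * (L : ℝ) * (Real.exp 1 * ((4 * d + 5) * L)) ^ k)))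
      ((Real.exp 1 * ((4 * d + 5) * L)) ^ k) := by
  intro X Y hX hY η hη hηle hnear
  have hL0 : (0 : ℝ) < (L : ℝ) := by exact_mod_cast (by omega : 0 < L)
  have hLk : (0 : ℝ) < ((L : ℝ) ^ k) ^ 2 := by positivity
  have hΛk : (0 : ℝ) < (Real.exp 1 * ((4 * d + 5) * L)) ^ k := by positivity
  have h1 : η ≤ ε / (4 * ((L : ℝ) ^ k) ^ 2) := hηle.trans (min_le_left _ _)
  have h2 : η ≤ 1 / (8 * (d + 1) * (L : ℝ) * (Real.exp 1 * ((4 * d + 5) * L)) ^ k) := hηle.trans (min_le_right _ _)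
  have hηε : 4 * η * ((L : ℝ) ^ k) ^ 2 ≤ ε := by
    rw [le_div_iff₀ (by positivity)] at h1; linarith
  have hηk : 8 * (d + 1) * (L : ℝ) * ((Real.exp 1 * ((4 * d + 5) * L)) ^ k * η) ≤ 1 := by
    rw [le_div_iff₀ (by positivity)] at h2
    have : 8 * (d + 1) * (L : ℝ) * ((Real.exp 1 * ((4 * d + 5) * L)) ^ k * η) = η * (8 * (d + 1) * (L : ℝ) * (Real.exp 1 * ((4 * d + 5) * L)) ^ k) := by ring
    rw [this]; exact h2
  intro x i
  rw [avgIterS_step42, avgIterS_step42]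
  exact norm_avgIter_sub_avgIter_le hL hX hY.1 hnear hη hε0 hε1 hε2 hY.2.2 hηε hηk le_rfl x i

/-- **THE CLASS-PROPAGATION INPUT `hmap₂`**: the one-step (43)-average of a member of `sfClass d L N ε (k+1)` is `U(N)`-valued ([Balaban1985Averaging] Prop. 2 at the first
level, `avgIter_unitary_smallField_two` with `j = 1`; `avgIter L U 1 = step42 L U`). [folklore] -/
theorem isUnitaryCfg_step42_of_mem_sfClass {k : ℕ} {U : Site d → Fin d → (Matrix n n ℂ)ˣ} (hU : U ∈ sfClass d L N ε (k + 1)) :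
    IsUnitaryCfg (step42 L U) := by
  have hε1' : 16 * C0 d * ε ≤ 3 := by have := C0_pos d; nlinarith
  have hε2' : 1024 * (d + 1) * (d + 4) * (L : ℝ) ^ 2 * ε ≤ 1 := by
    have : (0 : ℝ) ≤ 1024 * (d + 1) * (d + 4) * (L : ℝ) ^ 2 * ε := by positivity
    linarith
  have h := (avgIter_unitary_smallField_two hL hU.1 hε0 hε1' hε2' hU.2.2 (j := 1) (by omega)).1
  rwa [avgIter_succ, avgIter_zero] at h

variable {Γ : Subgroup (Matrix n n ℂ)ˣ} {s : ℕ → (Site d → Fin d → (Matrix n n ℂ)ˣ) → (Site d → Fin d → (Matrix n n ℂ)ˣ)}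

/-- **★★★ PART 29's (43)-TARGET INDUCTION ON N16's CLASSES WITH THE LIPSCHITZ INPUT AND `hmap₂` DISCHARGED** (gauges in any `Γ ≤ U(N)`): for ANY scheme `s`, (H1)
`ApproxSchemeGaugeEquivIn d Γ s (step42 L) L N k (sfClass d L N ε k) (δ k)` at every depth `k` follows from: the one-step defects `StepNear d Γ s (step42 L) L N j (sfClass … (j+1)) (η j)`
with `0 ≤ η j ≤ η₀ j := min (ε∕(4(L^j)²)) (1∕(8(d+1)L(e(4d+5)L)^j))`; class propagation `s (j+1) '' sfClass (j+1) ⊆ sfClass j` and the block-lift clause of `s`; and the defect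
recursion `0 ≤ δ 0`, `(e(4d+5)L)^j·η j + δ j ≤ δ (j+1)`.  ((43)'s fine covariance ∕ block-lift clause: part 29 §3; gauge invariance of `sfClass`: pub-balaban's `mem_sfClass_gaugeAct`;
Lipschitz control and `hmap₂`: §3 here.)  By part 27's `.symm` the same with the roles swapped; with part 27∕28 it feeds the END-number ∕ `ActionRate` transfer modulo the
right-inverse moduli. [folklore] -/
theorem approx_step42_target_of_steps_sfClass (hΓ : Γ ≤ unitaryUnits (Matrix n n ℂ)) {η δ : ℕ → ℝ}
    (hstep : ∀ j, StepNear d Γ s (fun _ => step42 L) L N j (sfClass d L N ε (j + 1)) (η j)) (hη0 : ∀ j, 0 ≤ η j)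
    (hηle : ∀ j, η j ≤ min (ε / (4 * ((L : ℝ) ^ j) ^ 2)) (1 / (8 * (d + 1) * (L : ℝ) * (Real.exp 1 * ((4 * d + 5) * L)) ^ j)))
    (hmap : ∀ j, ∀ U ∈ sfClass d L N ε (j + 1), s (j + 1) U ∈ sfClass d L N ε j)
    (cov₁ : ∀ (j : ℕ) (κ : Site d → (Matrix n n ℂ)ˣ) (U : Site d → Fin d → (Matrix n n ℂ)ˣ), (∀ x, κ x ∈ Γ) → IsPeriodicSite κ (N : ℤ) → U ∈ sfClass d L N ε j →
      avgIterS s j (gaugeAct (fun x : Site d => κ (fun i => x i / (L : ℤ) ^ j)) U) = gaugeAct κ (avgIterS s j U))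
    (hδ0 : 0 ≤ δ 0) (hδ : ∀ j, (Real.exp 1 * ((4 * d + 5) * L)) ^ j * η j + δ j ≤ δ (j + 1)) (k : ℕ) :
    ApproxSchemeGaugeEquivIn d Γ s (fun _ => step42 L) L N k (sfClass d L N ε k) (δ k) :=
  approx_step42_target_of_steps (𝒞₀ := fun _ => {V | IsUnitaryCfg V}) (𝒞 := sfClass d L N ε) hΓ (le_trans (by norm_num) hL) hstep hη0 hηle
    (fun j => lipschitzNear_step42_sfClass hL hε0 hε1 hε2 j) hmap (fun j U hU => isUnitaryCfg_step42_of_mem_sfClass hL hε0 hε1 hε2 hU)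
    (fun _ u W hu huP hW => NE3ResidualSliceRep.mem_sfClass_gaugeAct (fun x => hΓ (hu x)) huP hW) cov₁ hδ0 hδ k

/-- **★★★ THE SAME ON ANY GAUGE-INVARIANT SUB-CLASS FAMILY `𝒞 k ⊆ sfClass d L N ε k`** (e.g. the `Γ`-valued part of the small-field class — `Γ = SU(N)` for the (0.4) side):
Lipschitz control and `hmap₂` restrict from `sfClass`; displayed remain `StepNear` on `𝒞 (j+1)`, class propagation `s (j+1) '' 𝒞 (j+1) ⊆ 𝒞 j`, the block-lift clause of `s` on `𝒞 j`,
the `Γ`-invariance of `𝒞`, and the defect recursion. [folklore] -/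
theorem approx_step42_target_of_steps_subclass (hΓ : Γ ≤ unitaryUnits (Matrix n n ℂ)) {𝒞 : ℕ → Set (Site d → Fin d → (Matrix n n ℂ)ˣ)}
    (h𝒞 : ∀ k, 𝒞 k ⊆ sfClass d L N ε k)
    (hC : ∀ (k : ℕ) (u : Site d → (Matrix n n ℂ)ˣ) (W : Site d → Fin d → (Matrix n n ℂ)ˣ), (∀ x, u x ∈ Γ) →
      IsPeriodicSite u ((N * L ^ k : ℕ) : ℤ) → W ∈ 𝒞 k → gaugeAct u W ∈ 𝒞 k)
    {η δ : ℕ → ℝ}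
    (hstep : ∀ j, StepNear d Γ s (fun _ => step42 L) L N j (𝒞 (j + 1)) (η j)) (hη0 : ∀ j, 0 ≤ η j)
    (hηle : ∀ j, η j ≤ min (ε / (4 * ((L : ℝ) ^ j) ^ 2)) (1 / (8 * (d + 1) * (L : ℝ) * (Real.exp 1 * ((4 * d + 5) * L)) ^ j)))
    (hmap : ∀ j, ∀ U ∈ 𝒞 (j + 1), s (j + 1) U ∈ 𝒞 j)
    (cov₁ : ∀ (j : ℕ) (κ : Site d → (Matrix n n ℂ)ˣ) (U : Site d → Fin d → (Matrix n n ℂ)ˣ), (∀ x, κ x ∈ Γ) → IsPeriodicSite κ (N : ℤ) → U ∈ 𝒞 j →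
      avgIterS s j (gaugeAct (fun x : Site d => κ (fun i => x i / (L : ℤ) ^ j)) U) = gaugeAct κ (avgIterS s j U))
    (hδ0 : 0 ≤ δ 0) (hδ : ∀ j, (Real.exp 1 * ((4 * d + 5) * L)) ^ j * η j + δ j ≤ δ (j + 1)) (k : ℕ) :
    ApproxSchemeGaugeEquivIn d Γ s (fun _ => step42 L) L N k (𝒞 k) (δ k) :=
  approx_step42_target_of_steps (𝒞₀ := fun _ => {V | IsUnitaryCfg V}) (𝒞 := 𝒞) hΓ (le_trans (by norm_num) hL) hstep hη0 hηle
    (fun j => (lipschitzNear_step42_sfClass hL hε0 hε1 hε2 j).anti le_rfl (h𝒞 j)) hmap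
    (fun j U hU => isUnitaryCfg_step42_of_mem_sfClass hL hε0 hε1 hε2 (h𝒞 (j + 1) hU)) hC cov₁ hδ0 hδ k

omit hL hε0 hε1 hε2 in
/-- **THE `Γ`-VALUED PART OF THE SMALL-FIELD CLASS IS `Γ`-INVARIANT** (for `Γ ≤ U(N)`): `{U ∈ sfClass d L N ε k | U is Γ-valued}` is mapped to itself by every `Γ`-valued
`(N·L^k)`-periodic gauge (pub-balaban's `mem_sfClass_gaugeAct` + closure of `Γ` under products and inverses).  With `Γ = SU(N)` this is the class the (0.4) side of record
must be read on (part 23's (d1), part 27′). [folklore] -/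
theorem gaugeAct_mem_sfClass_inter (hΓ : Γ ≤ unitaryUnits (Matrix n n ℂ)) (k : ℕ) (u : Site d → (Matrix n n ℂ)ˣ) (W : Site d → Fin d → (Matrix n n ℂ)ˣ)
    (hu : ∀ x, u x ∈ Γ) (huP : IsPeriodicSite u ((N * L ^ k : ℕ) : ℤ))
    (hW : W ∈ {U | U ∈ sfClass d L N ε k ∧ ∀ x i, U x i ∈ Γ}) :
    gaugeAct u W ∈ {U | U ∈ sfClass d L N ε k ∧ ∀ x i, U x i ∈ Γ} :=
  ⟨NE3ResidualSliceRep.mem_sfClass_gaugeAct (fun x => hΓ (hu x)) huP hW.1,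
    fun x i => Γ.mul_mem (Γ.mul_mem (hu x) (hW.2 x i)) (Γ.inv_mem (hu _))⟩

/-- **★★★ ON THE `Γ`-VALUED PART OF N16's SMALL-FIELD CLASS** (`𝒞 k := {U ∈ sfClass d L N ε k | U Γ-valued}`; `Γ = SU(N)`: the (0.4) side's class): (H1) against (43)
at every depth for ANY scheme `s` ⇐ `StepNear` per step on `𝒞 (j+1)` + class propagation and block-lift clause of `s` on `𝒞` + the defect recursion — Lipschitz control, `hmap₂`,
(43)'s covariance and the `Γ`-invariance of `𝒞` all DISCHARGED. [folklore] -/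
theorem approx_step42_target_of_steps_memClass (hΓ : Γ ≤ unitaryUnits (Matrix n n ℂ)) {η δ : ℕ → ℝ}
    (hstep : ∀ j, StepNear d Γ s (fun _ => step42 L) L N j {U | U ∈ sfClass d L N ε (j + 1) ∧ ∀ x i, U x i ∈ Γ} (η j)) (hη0 : ∀ j, 0 ≤ η j)
    (hηle : ∀ j, η j ≤ min (ε / (4 * ((L : ℝ) ^ j) ^ 2)) (1 / (8 * (d + 1) * (L : ℝ) * (Real.exp 1 * ((4 * d + 5) * L)) ^ j)))
    (hmap : ∀ j, ∀ U ∈ {U | U ∈ sfClass d L N ε (j + 1) ∧ ∀ x i, U x i ∈ Γ}, s (j + 1) U ∈ {U | U ∈ sfClass d L N ε j ∧ ∀ x i, U x i ∈ Γ})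
    (cov₁ : ∀ (j : ℕ) (κ : Site d → (Matrix n n ℂ)ˣ) (U : Site d → Fin d → (Matrix n n ℂ)ˣ), (∀ x, κ x ∈ Γ) → IsPeriodicSite κ (N : ℤ) →
      U ∈ {U | U ∈ sfClass d L N ε j ∧ ∀ x i, U x i ∈ Γ} →
      avgIterS s j (gaugeAct (fun x : Site d => κ (fun i => x i / (L : ℤ) ^ j)) U) = gaugeAct κ (avgIterS s j U))
    (hδ0 : 0 ≤ δ 0) (hδ : ∀ j, (Real.exp 1 * ((4 * d + 5) * L)) ^ j * η j + δ j ≤ δ (j + 1)) (k : ℕ) :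
    ApproxSchemeGaugeEquivIn d Γ s (fun _ => step42 L) L N k {U | U ∈ sfClass d L N ε k ∧ ∀ x i, U x i ∈ Γ} (δ k) :=
  approx_step42_target_of_steps_subclass (𝒞 := fun k => {U | U ∈ sfClass d L N ε k ∧ ∀ x i, U x i ∈ Γ}) hL hε0 hε1 hε2 hΓ (fun _ _ hU => hU.1)
    (fun k u W hu huP hW => gaugeAct_mem_sfClass_inter hΓ k u W hu huP hW) hstep hη0 hηle hmap cov₁ hδ0 hδ k

end Packaging

end

end Summit.QuantumFields.YangMills.BalabanUVNodes.N16Eq42LipschitzOrbit
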